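import Summits.ABC.StewartYu.PadicG3VbSizes
import Summits.ABC.StewartYu.PadicG3ParVL
import HarnessLib

/-!
# Cell abc-stewartyu, crux `Y07Odd` (stmt-ABC-19658), `m = 0` branch: the BUDGET ATOMS of the record schedule in the unit `Zp = G·g·XV·LgV`
# and the k-step LINES (far branch and `Λ`-branch) at `P.schedVb b`

`Summits/ABC/StewartYu/PadicG3VbBudget.lean` — cell `abc-stewartyu` (seat p3-g7).  Theorems only, no named fact.  Under the `m = 0` context
(`P.m = 0`, `P.θ₀ = ½`, `P.Nq = P.K`, `P.K₀ = p − 1`, so `log p = 2G`, `K ≤ p`, `ŜG·log 2 ≤ (2n+26)·log 2 + 2G + g − 1`, `yloadG ≥ 7G`,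
`XV ≥ 252(n+1)/g`): every cost atom of `PadicG3VbSizesB` is a fraction of `Zp` — `(n+1)·HV·LgV ≤ Zp/(64g)`, `(n+1)·G·LgV ≤ Zp/252`,
`(n+1)·LgV ≤ Zp/(2016(n+1)g)`, `T₀ʳ·ŜG·log 2 ≤ (21/100)·Zp`, `T₀ʳ·HV ≤ (69/256)·Zp/g`, `T₀ʳ·2·log n ≤ Zp/50`, `L0V·(G+1) ≤ Zp/26 + G + 1`,
`AV⁺ ≤ (27/100)·Zp + yloadG + 1` — hence the k-step Liouville constant costs `≤ (5/2 + (33/64)·2^ν)·Zp` and every k-step line of the pack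
closes: far branch `log BwP + log KC < zerosV lev ν` (`≥ 8·2^ν·Zp`), `Λ`-branch `log BwP + log KC + AcondV lev ν < 8·2ⁿ·Zp + CondFloorV n ≤ U`.

References: Yu. V. Nesterenko, LNM 1819 (2003) §4.2 (4.29)–(4.35); K. Yu, Acta Math. 211 (2013) §3.1.
-/

noncomputable section

open Finset Real
open Literature.NumberTheory.Transcendental

namespace Summit.ABC.StewartYu

namespace PadicG3Par

variable {n : ℕ} (P : PadicG3Par n)

/-! ### Atoms in the unit `Zp` -/

/-- `G·XV·LgV = Zp/g`. [folklore] -/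
theorem G_XV_LgV_eq : P.G * P.XV * P.LgV = P.Zp / P.g := by
  have hg : 0 < P.g := lt_of_lt_of_le zero_lt_one P.one_le_g
  unfold Zp; field_simp

/-- **`(n+1)·HV·LgV ≤ Zp/(64 g)`** (`HV ≤ G XV/(64(n+1))`). [folklore] -/
theorem succ_HV_LgV_le : ((n : ℝ) + 1) * P.HV * P.LgV ≤ P.Zp / (64 * P.g) := by
  have h := P.HV_le
  have hL : (0 : ℝ) ≤ P.LgV := by positivity
  have hg : 0 < P.g := lt_of_lt_of_le zero_lt_one P.one_le_g
  have h1 : ((n : ℝ) + 1) * P.HV ≤ P.G * P.XV / 64 := by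
    rw [le_div_iff₀ (by positivity)] at h; linarith
  calc ((n : ℝ) + 1) * P.HV * P.LgV ≤ P.G * P.XV / 64 * P.LgV := mul_le_mul_of_nonneg_right h1 hL
    _ = P.Zp / (64 * P.g) := by unfold Zp; field_simp

/-- **`(n+1)·G·LgV ≤ Zp/(64 g)`** (`XV ≥ 64(n+1)`). [folklore] -/
theorem succ_G_LgV_le : ((n : ℝ) + 1) * P.G * P.LgV ≤ P.Zp / (64 * P.g) := by
  have hX := P.sixtyfour_le_XV'
  have hg : 0 < P.g := lt_of_lt_of_le zero_lt_one P.one_le_g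
  have hG : 0 ≤ P.G := by linarith [P.eight_le_G]
  have hL : (0 : ℝ) ≤ P.LgV := by positivity
  rw [le_div_iff₀ (by positivity)]
  unfold Zp
  nlinarith [mul_nonneg (mul_nonneg hG hL) hg.le, mul_le_mul_of_nonneg_left hX (mul_nonneg (mul_nonneg hG hL) hg.le)]

/-- at `m = 0`, `N_q = K`, `K₀ = p − 1`: **`yloadG ≥ 7G`** (`2 log p = 4G`, `(ŜG+n+1) log 2 ≥ log N_q ≥ log(p/2) = 2G − log 2`). [folklore] -/
theorem seven_G_le_yloadG (hm : P.m = 0) (hθ : P.θ₀ = 1 / 2) (hNq : P.Nq = P.K) (hK₀ : (P.K₀ : ℝ) = P.p - 1) :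
    7 * P.G ≤ P.yloadG := by
  have hG := P.G_eq_half_log hm hθ
  have hp2 := P.two_le_p
  have hlogp := P.log_p_pos
  -- `log Nq ≥ log p − log 2`
  have hK : (P.K : ℝ) = P.p - 1 := by
    unfold K; rw [hm, pow_zero, one_mul]; exact hK₀
  have hNqr : (P.Nq : ℝ) = P.p - 1 := by rw [hNq]; exact hK
  have hNq2 : (P.p : ℝ) / 2 ≤ P.Nq := by rw [hNqr]; linarith
  have hlogNq : Real.log P.p - Real.log 2 ≤ Real.log P.Nq := by
    rw [← Real.log_div (by linarith) (by norm_num)]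
    exact Real.log_le_log (by linarith) hNq2
  -- `log Nq < (Nat.log 2 Nq + 1) log 2`
  have hNq1 : 1 ≤ P.Nq := P.hNq
  have hlt : P.Nq < 2 ^ (Nat.log 2 P.Nq + 1) := Nat.lt_pow_succ_log_self (by norm_num) _
  have hltR : (P.Nq : ℝ) < 2 ^ (Nat.log 2 P.Nq + 1) := by exact_mod_cast hlt
  have hlog2 : Real.log P.Nq < ((Nat.log 2 P.Nq : ℕ) + 1 : ℝ) * Real.log 2 := by
    have := Real.log_lt_log (by exact_mod_cast (show 0 < P.Nq by omega)) hltR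
    rw [Real.log_pow] at this
    push_cast at this
    exact this
  -- `SdG ≥ n + 24 + Nat.log 2 Nq`
  have hSd : ((n + 24 + Nat.log 2 P.Nq : ℕ) : ℝ) ≤ P.SdG := by
    have : n + 24 + Nat.log 2 P.Nq ≤ P.SdG := by unfold SdG; omega
    exact_mod_cast this
  push_cast at hSd
  have hl2 : (0 : ℝ) < Real.log 2 := Real.log_pos (by norm_num)
  have hl2' : Real.log 2 < 1 := by have := Real.log_two_lt_d9; linarith
  have hlogn : (0 : ℝ) ≤ Real.log (n + 1) := Real.log_nonneg (by linarith [(Nat.cast_nonneg n : (0:ℝ) ≤ n)])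
  unfold yloadG
  nlinarith [mul_le_mul_of_nonneg_right hSd hl2.le]

/-- at `m = 0` …: **`252·(n+1) ≤ g·XV`** (`XV ≥ XE ≥ 36(n+1)yloadG/(Gg)`, `yloadG ≥ 7G`). [folklore] -/
theorem XV_ge_252 (hm : P.m = 0) (hθ : P.θ₀ = 1 / 2) (hNq : P.Nq = P.K) (hK₀ : (P.K₀ : ℝ) = P.p - 1) :
    252 * ((n : ℝ) + 1) ≤ P.g * P.XV := by
  have hXE := P.XE_le_XV
  have hmain := P.mainV_le_LgV
  have hy := P.seven_G_le_yloadG hm hθ hNq hK₀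
  have hg : 0 < P.g := lt_of_lt_of_le zero_lt_one P.one_le_g
  have hG : 0 < P.G := by linarith [P.eight_le_G]
  have hΩ := P.Ω_pos
  have hK := P.K_pos
  have hCb : (0 : ℝ) < Cb ^ n := pow_pos (by linarith [two_le_Cb]) n
  have hden : (0 : ℝ) < Cb ^ n * P.Ω * P.K := by positivity
  have hn1 : 1 ≤ n := P.hn
  -- `LgV·g^{n−1}/(Cbⁿ Ω K) ≥ 24 yloadG/(G g)`
  have hgn : P.g ^ n = P.g ^ (n - 1) * P.g := P.pow_g_eq
  have h1 : 24 * P.yloadG / (P.G * P.g) ≤ P.LgV * P.g ^ (n - 1) / (Cb ^ n * P.Ω * P.K) := by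
    rw [div_le_div_iff₀ (by positivity) hden]
    rw [div_le_iff₀ (by positivity)] at hmain
    rw [hgn] at hmain
    have hgp : (0 : ℝ) < P.g ^ (n - 1) := by positivity
    nlinarith [mul_le_mul_of_nonneg_right hmain hgp.le]
  have h2 : (3 / 2) * (n + 1) * (24 * P.yloadG / (P.G * P.g)) ≤ P.XV := by
    refine le_trans ?_ hXE
    have : (3 / 2 : ℝ) * (n + 1) * (P.LgV * P.g ^ (n - 1) / (Cb ^ n * P.Ω * P.K)) =
        3 / 2 * (n + 1) * P.LgV * P.g ^ (n - 1) / (Cb ^ n * P.Ω * P.K) := by ring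
    rw [← this]
    exact mul_le_mul_of_nonneg_left h1 (by positivity)
  have h3 : (3 / 2 : ℝ) * (n + 1) * (24 * P.yloadG / (P.G * P.g)) * P.g = 36 * (n + 1) * (P.yloadG / P.G) := by
    field_simp; ring
  have h4 : 7 ≤ P.yloadG / P.G := by rw [le_div_iff₀ hG]; linarith
  nlinarith [mul_le_mul_of_nonneg_right h2 hg.le]

/-- at `m = 0` …: **`(n+1)·G·LgV ≤ Zp/252`**. [folklore] -/
theorem succ_G_LgV_le' (hm : P.m = 0) (hθ : P.θ₀ = 1 / 2) (hNq : P.Nq = P.K) (hK₀ : (P.K₀ : ℝ) = P.p - 1) :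
    ((n : ℝ) + 1) * P.G * P.LgV ≤ P.Zp / 252 := by
  have hX := P.XV_ge_252 hm hθ hNq hK₀
  have hG : 0 ≤ P.G := by linarith [P.eight_le_G]
  have hL : (0 : ℝ) ≤ P.LgV := by positivity
  rw [le_div_iff₀ (by norm_num)]
  unfold Zp
  nlinarith [mul_le_mul_of_nonneg_left hX (mul_nonneg hG hL)]

/-- at `m = 0` …: **`(n+1)·LgV ≤ Zp/(2016·(n+1)·g)`** (`G = 8(n+1)g`). [folklore] -/
theorem succ_LgV_le (hm : P.m = 0) (hθ : P.θ₀ = 1 / 2) (hNq : P.Nq = P.K) (hK₀ : (P.K₀ : ℝ) = P.p - 1) :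
    ((n : ℝ) + 1) * P.LgV ≤ P.Zp / (2016 * (n + 1) * P.g) := by
  have hX := P.XV_ge_252 hm hθ hNq hK₀
  have hg : 0 < P.g := lt_of_lt_of_le zero_lt_one P.one_le_g
  have hL : (0 : ℝ) ≤ P.LgV := by positivity
  rw [le_div_iff₀ (by positivity)]
  unfold Zp
  rw [P.G_eq_mul_g]
  nlinarith [mul_le_mul_of_nonneg_left hX (mul_nonneg (mul_nonneg (by positivity : (0:ℝ) ≤ 8 * ((n:ℝ)+1)) hg.le) hL)]

/-- at `m = 0`, `θ₀ = ½`, `N_q ≤ 2ⁿK`: **`ŜG·log 2 ≤ (2n+26)·log 2 + 2G + (g − 1)`** (`2^ŜG < 2^{n+26} N_q g`, `K ≤ p`, `log p = 2G`). [folklore] -/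
theorem SdG_log_le (hm : P.m = 0) (hθ : P.θ₀ = 1 / 2) (hNqK : P.Nq ≤ 2 ^ n * P.K) :
    (P.SdG : ℝ) * Real.log 2 ≤ (2 * n + 26) * Real.log 2 + 2 * P.G + (P.g - 1) := by
  have h := P.two_pow_SdG_lt
  have hG := P.G_eq_half_log hm hθ
  have hKp := P.K_le_p hm
  have hK := P.K_pos
  have hg : 0 < P.g := lt_of_lt_of_le zero_lt_one P.one_le_g
  have hNq1 : (1 : ℝ) ≤ P.Nq := by exact_mod_cast P.hNq
  have hNqK' : (P.Nq : ℝ) ≤ 2 ^ n * P.K := by exact_mod_cast hNqK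
  have hlog := Real.log_lt_log (by positivity) h
  rw [Real.log_pow, Real.log_mul (by positivity) hg.ne', Real.log_mul (by positivity) (by positivity), Real.log_pow] at hlog
  have hlogNq : Real.log P.Nq ≤ n * Real.log 2 + Real.log P.p := by
    calc Real.log P.Nq ≤ Real.log (2 ^ n * P.K) := Real.log_le_log (by positivity) hNqK'
      _ = n * Real.log 2 + Real.log P.K := by rw [Real.log_mul (by positivity) hK.ne', Real.log_pow]
      _ ≤ n * Real.log 2 + Real.log P.p := by linarith [Real.log_le_log hK hKp]
  have hlogg : Real.log P.g ≤ P.g - 1 := Real.log_le_sub_one_of_pos hg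
  push_cast at hlog ⊢
  linarith

/-- `T₀ʳ·(ŜG·log 2) ≤ (21/100)·Zp` at `m = 0` (`T₀ʳ = (69/4)(n+1)LgV`, `n ≥ 2`). [folklore] -/
theorem T0r_SdG_le (hm : P.m = 0) (hθ : P.θ₀ = 1 / 2) (hNq : P.Nq = P.K) (hK₀ : (P.K₀ : ℝ) = P.p - 1) (hn2 : 2 ≤ n) :
    (69 / 4) * ((n : ℝ) + 1) * P.LgV * (P.SdG * Real.log 2) ≤ (21 / 100) * P.Zp := by
  have hNqK : P.Nq ≤ 2 ^ n * P.K := by rw [hNq]; exact Nat.le_mul_of_pos_left _ (by positivity)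
  have hS := P.SdG_log_le hm hθ hNqK
  have h1 := P.succ_G_LgV_le' hm hθ hNq hK₀
  have h2 := P.succ_LgV_le hm hθ hNq hK₀
  have hZ := P.Zp_facts.1
  have hg1 := P.one_le_g
  have hL : (0 : ℝ) ≤ P.LgV := by positivity
  have hn : (2 : ℝ) ≤ n := by exact_mod_cast hn2
  have hl2 : Real.log 2 < 0.6931471808 := Real.log_two_lt_d9
  have hl20 : 0 < Real.log 2 := Real.log_pos (by norm_num)
  -- `(n+1)LgV·((2n+26) log 2 + g − 1) ≤ Zp·8/2016` (as `(2n+26) log 2 + g − 1 ≤ 8(n+1)g`)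
  have hc : (0 : ℝ) ≤ (2 * n + 26) * Real.log 2 + (P.g - 1) := by nlinarith
  have hcle : (2 * (n : ℝ) + 26) * Real.log 2 + (P.g - 1) ≤ 8 * ((n : ℝ) + 1) * P.g := by nlinarith
  have h3 : ((n : ℝ) + 1) * P.LgV * ((2 * n + 26) * Real.log 2 + (P.g - 1)) ≤ P.Zp * (8 / 2016) := by
    have h := mul_le_mul_of_nonneg_right h2 hc
    refine h.trans ?_
    rw [div_mul_eq_mul_div, div_le_iff₀ (by positivity)]
    nlinarith [mul_le_mul_of_nonneg_left hcle hZ.le]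
  have hmul := mul_le_mul_of_nonneg_left hS (by positivity : (0:ℝ) ≤ (69 / 4) * ((n : ℝ) + 1) * P.LgV)
  linarith [hmul, h3, h1]

/-- `T₀ʳ·HV ≤ (69/256)·Zp/g`. [folklore] -/
theorem T0r_HV_le : (69 / 4) * ((n : ℝ) + 1) * P.LgV * P.HV ≤ (69 / 256) * (P.Zp / P.g) := by
  have h := P.succ_HV_LgV_le
  have hg : 0 < P.g := lt_of_lt_of_le zero_lt_one P.one_le_g
  have : P.Zp / (64 * P.g) = (P.Zp / P.g) / 64 := by field_simp
  rw [this] at h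
  nlinarith

/-- `T₀ʳ·(2 log n) ≤ Zp/50` at `m = 0`. [folklore] -/
theorem T0r_logn_le (hm : P.m = 0) (hθ : P.θ₀ = 1 / 2) (hNq : P.Nq = P.K) (hK₀ : (P.K₀ : ℝ) = P.p - 1) :
    (69 / 4) * ((n : ℝ) + 1) * P.LgV * (2 * Real.log n) ≤ P.Zp / 50 := by
  have h2 := P.succ_LgV_le hm hθ hNq hK₀
  have hZ := P.Zp_facts.1
  have hg := P.one_le_g
  have hn1 : (1 : ℝ) ≤ n := by exact_mod_cast P.hn
  have hlogn : Real.log n ≤ n - 1 := Real.log_le_sub_one_of_pos (by linarith)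
  have hlogn0 : 0 ≤ Real.log (n : ℝ) := Real.log_nonneg hn1
  have h3 : ((n : ℝ) + 1) * P.LgV * Real.log n ≤ P.Zp / 2016 := by
    have := mul_le_mul_of_nonneg_right h2 hlogn0
    refine this.trans ?_
    rw [div_mul_eq_mul_div, div_le_div_iff₀ (by positivity) (by norm_num)]
    have : Real.log (n : ℝ) * 2016 ≤ 2016 * ((n : ℝ) + 1) * P.g := by nlinarith
    nlinarith
  nlinarith

/-- `L0V·(G+1) ≤ Zp/26 + G + 1` at `m = 0` (`L0V ≤ Zp/(4 yloadG) + 1`, `yloadG ≥ 7G`, `G ≥ 16`). [folklore] -/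
theorem L0V_G_le (hm : P.m = 0) (hθ : P.θ₀ = 1 / 2) (hNq : P.Nq = P.K) (hK₀ : (P.K₀ : ℝ) = P.p - 1) :
    (P.L0V : ℝ) * (P.G + 1) ≤ P.Zp / 26 + P.G + 1 := by
  have hL := P.L0V_le
  have hy := P.seven_G_le_yloadG hm hθ hNq hK₀
  have hG := P.sixteen_le_G
  have hZ := P.Zp_facts.1
  have hypos := P.yloadG_pos
  unfold Zp at *
  -- `L0V ≤ Z/(4y) + 1 ≤ Z/(28 G) + 1`
  have hG0 : (0 : ℝ) < 28 * P.G := by linarith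
  have h1 : (P.L0V : ℝ) ≤ P.G * (P.g * P.XV * P.LgV) / (28 * P.G) + 1 := by
    have := div_le_div_of_nonneg_left hZ.le hG0 (by linarith : 28 * P.G ≤ 4 * P.yloadG)
    linarith
  have h2 : P.G * (P.g * P.XV * P.LgV) / (28 * P.G) * (P.G + 1) ≤ P.G * (P.g * P.XV * P.LgV) / 26 := by
    rw [div_mul_eq_mul_div, div_le_div_iff₀ hG0 (by norm_num)]
    nlinarith
  have hG1 : (0 : ℝ) ≤ P.G + 1 := by linarith
  nlinarith [mul_le_mul_of_nonneg_right h1 hG1]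

/-- `AV⁺ = L0V·(ŜG+n+6)·log 2 ≤ (27/100)·Zp + yloadG + 1`. [folklore] -/
theorem AVp_le : (P.L0V : ℝ) * ((P.SdG + n + 6) * Real.log 2) ≤ (27 / 100) * P.Zp + P.yloadG + 1 := by
  have h1 := P.AVV_le
  have h2 := P.L0V_le_Zp
  unfold AVV at h1
  have hl2 : Real.log 2 < 0.6931471808 := Real.log_two_lt_d9
  have hl20 : 0 < Real.log 2 := Real.log_pos (by norm_num)
  have hL0 : (0 : ℝ) ≤ P.L0V := by positivity
  have : (P.L0V : ℝ) * ((P.SdG + n + 6) * Real.log 2) = P.L0V * ((P.SdG + n + 5) * Real.log 2) + P.L0V * Real.log 2 := by ring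
  rw [this]
  have hZ := P.Zp_facts.1
  have h3 : (P.L0V : ℝ) * Real.log 2 ≤ (P.Zp / 64 + 1) * Real.log 2 := mul_le_mul_of_nonneg_right h2 hl20.le
  have h4 : (P.Zp / 64 + 1) * Real.log 2 ≤ (P.Zp / 64 + 1) * 0.6931471808 := mul_le_mul_of_nonneg_left hl2.le (by positivity)
  linarith

end PadicG3Par

end Summit.ABC.StewartYu

end
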